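import Mathlib
import Literature.Probability.LatticeModels.ProdBernoulliIndependence
import Literature.Probability.Percolation.ConditionalPositiveAssociation
import Literature.Probability.Percolation.ConditionalPositiveAssociationProofs
import Literature.Probability.Percolation.TwoClusterConditionalAssociation
import Literature.Probability.Percolation.PercolationProofs
import Literature.Probability.Percolation.ClusterBoundary
import HarnessLib

/-!
# Crux `PercNearOneGluing.NearOneGluing` (stmt-CriticalPhenomena-4574), line `bhk-dyadic-thinning`
# — sub-goal `freshPocketAveraging`

Helper file for the crux (lead prover-line-stmt-CriticalPhenomena-4574-0, wave 2): tooling / partial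
result for the residual `stub_doomWindow`.  Proves exactly the registered sub-goal signature; lands
with `--supports stmt-CriticalPhenomena-4574`.

FRESH-POCKET AVERAGING.  `μ = prodBernoulli w` on `Set (Sym2 (Fin n))` (the complete weighted
graph), `C(b) = openCluster ω b`, `{o ↮ X} = (⋃_{a ∈ X} openConn o a)ᶜ`.  For every vertex set `X`,
`Σ_{K ∌ o} μ(C(b) = K) · μ(o ↮ X ∖ K) ≤ μ(o ↮ X ∧ o ↮ b)`.

Proof.  Fix `K ∌ o` and put `Cl_K = {C(b) = K} = clusterIs b K`,
`Off_K = (⋃_{a ∈ X ∖ K} {o ↔ a in Kᶜ})ᶜ`.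
* monotonicity in the graph: `{o ↔ a in Kᶜ} ⊆ {o ↔ a}`, so `μ(o ↮ X ∖ K) ≤ μ(Off_K)`;
* spatial Markov / disjoint supports: `Cl_K` is determined by the pairs touching `K`, `Off_K` by
  the pairs inside `Kᶜ`, hence `μ(Cl_K ∩ Off_K) = μ(Cl_K) μ(Off_K)`;
* pointwise: on `Cl_K ∩ Off_K`, `o ↮ b` (as `o ∉ K = C(b)`) and `o ↮ a` for every `a ∈ X` (an
  open walk from `o` avoids `K = C(b)`, so it is a walk inside `Kᶜ` ending at some `a ∈ X ∖ K`);
* the events `Cl_K` are pairwise disjoint, so the sum over `K` of `μ(Cl_K ∩ {o ↮ X, o ↮ b})` is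
  at most `μ(o ↮ X, o ↮ b)`.
-/

namespace Summit.CriticalPhenomena.PercolationContinuityZ3.Theorems

open scoped BigOperators Classical
open MeasureTheory Set
open Literature.Probability.LatticeModels (prodBernoulli prodBernoulli_real_inter_of_determinedBy)
open Literature.Probability.Percolation
open Literature.Barriers.CriticalPhenomena (pathIn_of_walk_support_subset)

/-! ### Pointwise inclusion -/

/-- If `C(b) = K ∌ o` and `o` reaches no vertex of `X ∖ K` by an open path inside `Kᶜ`, then
`o ↮ a` for every `a ∈ X` and `o ↮ b`: an open walk from `o` never meets `K = C(b)` (otherwise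
`o ∈ C(b)`), so it is a walk inside `Kᶜ`. [folklore; Grimmett 1999 §1.3] -/
private theorem clusterIs_inter_off_subset {V : Type*} [DecidableEq V] (X K : Finset V) {o : V}
    (b : V) (ho : o ∉ K) :
    clusterIs b K ∩ (⋃ a ∈ X \ K, openConnIn ((↑K : Set V)ᶜ) o a)ᶜ ⊆
      (⋃ a ∈ X, openConn o a)ᶜ ∩ (openConn o b)ᶜ := by
  rintro ω ⟨hK, hoff⟩
  rw [mem_clusterIs] at hK
  -- no vertex reachable from `o` lies in `K`
  have hreach : ∀ v, (openGraph ω).Reachable o v → v ∉ (↑K : Set V) := by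
    intro v hv hvK
    have hbv : (openGraph ω).Reachable b v := by
      have : v ∈ openCluster ω b := by rw [hK]; exact hvK
      exact this
    have hob : o ∈ openCluster ω b := hbv.trans hv.symm
    rw [hK] at hob
    exact ho (by exact_mod_cast hob)
  refine ⟨?_, ?_⟩
  · rw [Set.mem_compl_iff, Set.mem_iUnion₂]
    rintro ⟨a, haX, hoa⟩
    obtain ⟨p⟩ := (hoa : (openGraph ω).Reachable o a)
    have hsupp : ∀ v ∈ p.support, v ∈ (↑K : Set V)ᶜ := fun v hv =>
      hreach v ⟨p.takeUntil v hv⟩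
    have haK : a ∉ K := fun h => hreach a ⟨p⟩ (by exact_mod_cast h)
    apply hoff
    rw [Set.mem_iUnion₂]
    exact ⟨a, Finset.mem_sdiff.2 ⟨haX, haK⟩,
      DCT16.mem_openConnIn_of_pathIn (pathIn_of_walk_support_subset p hsupp)⟩
  · intro hob
    have hbK : b ∈ (↑K : Set V) := by
      have : b ∈ openCluster ω b := mem_openCluster_self ω b
      rwa [hK] at this
    exact hreach b hob hbK

/-! ### Monotonicity in the graph and disjoint-support independence -/

/-- `{o ↮ X ∖ K} ⊆ Off_K`: a connection inside `Kᶜ` is a connection. [folklore] -/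
private theorem compl_iUnion_openConn_subset_off {V : Type*} (Y : Finset V) (S : Set V) (o : V) :
    (⋃ a ∈ Y, openConn o a)ᶜ ⊆ ((⋃ a ∈ Y, openConnIn S o a)ᶜ : Set (BondConfig V)) :=
  Set.compl_subset_compl.2 (Set.iUnion₂_mono fun a _ => openConnIn_subset_openConn S o a)

/-- `Off = (⋃_{a ∈ Y} {o ↔ a in S})ᶜ` is determined by the pairs inside `S`.
[folklore; Grimmett 1999 §2.2] -/
private theorem determinedBy_off {V : Type*} (Y : Finset V) (S : Set V) (o : V) :
    DeterminedBy ((⋃ a ∈ Y, openConnIn S o a)ᶜ : Set (BondConfig V)) S.sym2 :=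
  DeterminedBy.compl (DeterminedBy.iUnion fun a => DeterminedBy.iUnion fun _ =>
    DCT16.determinedBy_openConnIn S o a le_rfl)

/-- **Spatial Markov property for the cluster of `b`** (disjoint supports): `{C(b) = K}` is
determined by the pairs touching `K`, `Off_K` by the pairs inside `Kᶜ`, so they are independent
under the product measure `prodBernoulli w`. [folklore; Grimmett 1999 §2.2] -/
private theorem real_clusterIs_inter_off {n : ℕ} (w : Sym2 (Fin n) → unitInterval) (b o : Fin n)
    (K Y : Finset (Fin n)) :
    (prodBernoulli w).real
        (clusterIs b K ∩ (⋃ a ∈ Y, openConnIn ((↑K : Set (Fin n))ᶜ) o a)ᶜ) =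
      (prodBernoulli w).real (clusterIs b K) *
        (prodBernoulli w).real (⋃ a ∈ Y, openConnIn ((↑K : Set (Fin n))ᶜ) o a)ᶜ := by
  set F : Finset (Sym2 (Fin n)) := (Set.toFinite (edgesTouching (↑K : Set (Fin n)))).toFinset
    with hF
  have hFc : (↑F : Set (Sym2 (Fin n))) = edgesTouching (↑K : Set (Fin n)) := by
    rw [hF, Set.Finite.coe_toFinset]
  refine prodBernoulli_real_inter_of_determinedBy w F ?_ ?_ MeasurableSet.of_discrete
    MeasurableSet.of_discrete
  · rw [hFc]; exact determinedBy_clusterIs b K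
  · rw [hFc]
    exact (determinedBy_off Y _ o).mono (disjoint_edgesTouching_compl_sym2 _).subset_compl_left

/-! ### The averaged inequality -/

/-- FRESH-POCKET AVERAGING (line independent-bad-world, stub 1; spatial Markov for `C(b)` + graph monotonicity, averaged over the cluster law): for every vertex set `X`, `Σ_{K ∌ o} μ(C(b) = K)·μ(o ↮ X∖K) ≤ μ(o ↮ X ∧ o ↮ b)`. [folklore; Grimmett 1999 §1.3, BHK 2006 Lemma 2.3 (q = 1)] -/
theorem freshPocketAveraging :
    ∀ (n : ℕ) (w : Sym2 (Fin n) → unitInterval) (X : Finset (Fin n)) (o b : Fin n), ∑ K ∈ (Finset.univ : Finset (Finset (Fin n))).filter (fun K => o ∉ K), (Literature.Probability.LatticeModels.prodBernoulli w).real {ω | Literature.Probability.Percolation.openCluster ω b = (K : Set (Fin n))} * (Literature.Probability.LatticeModels.prodBernoulli w).real (⋃ a ∈ X \ K, Literature.Probability.Percolation.openConn o a)ᶜ ≤ (Literature.Probability.LatticeModels.prodBernoulli w).real ((⋃ a ∈ X, Literature.Probability.Percolation.openConn o a)ᶜ ∩ (Literature.Probability.Percolation.openConn o b)ᶜ) :=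 by
  intro n w X o b
  set μ := prodBernoulli w with hμ
  set T : Set (Set (Sym2 (Fin n))) := (⋃ a ∈ X, openConn o a)ᶜ ∩ (openConn o b)ᶜ with hT
  set I : Finset (Finset (Fin n)) :=
    (Finset.univ : Finset (Finset (Fin n))).filter (fun K => o ∉ K) with hI
  -- termwise bound
  have key : ∀ K ∈ I, μ.real {ω | openCluster ω b = (K : Set (Fin n))} *
      μ.real (⋃ a ∈ X \ K, openConn o a)ᶜ ≤ μ.real (clusterIs b K ∩ T) := by
    intro K hK
    have ho : o ∉ K := (Finset.mem_filter.1 hK).2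
    calc μ.real {ω | openCluster ω b = (K : Set (Fin n))} *
          μ.real (⋃ a ∈ X \ K, openConn o a)ᶜ
        ≤ μ.real (clusterIs b K) *
            μ.real (⋃ a ∈ X \ K, openConnIn ((↑K : Set (Fin n))ᶜ) o a)ᶜ :=
          mul_le_mul_of_nonneg_left (measureReal_mono (compl_iUnion_openConn_subset_off _ _ o))
            measureReal_nonneg
      _ = μ.real
            (clusterIs b K ∩ (⋃ a ∈ X \ K, openConnIn ((↑K : Set (Fin n))ᶜ) o a)ᶜ) :=
          (real_clusterIs_inter_off w b o K (X \ K)).symm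
      _ ≤ μ.real (clusterIs b K ∩ T) :=
          measureReal_mono (Set.subset_inter Set.inter_subset_left
            (clusterIs_inter_off_subset X K b ho))
  calc ∑ K ∈ I, μ.real {ω | openCluster ω b = (K : Set (Fin n))} *
        μ.real (⋃ a ∈ X \ K, openConn o a)ᶜ
      ≤ ∑ K ∈ I, μ.real (clusterIs b K ∩ T) := Finset.sum_le_sum key
    _ = μ.real (⋃ K ∈ I, (clusterIs b K ∩ T)) := by
        rw [measureReal_biUnion_finset]
        · exact fun K _ L _ hKL => Disjoint.mono Set.inter_subset_left Set.inter_subset_left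
            (pairwise_disjoint_clusterIs b hKL)
        · exact fun K _ => MeasurableSet.of_discrete
    _ ≤ μ.real T := measureReal_mono (Set.iUnion₂_subset fun K _ => Set.inter_subset_right)

end Summit.CriticalPhenomena.PercolationContinuityZ3.Theorems
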